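import Summits.BirchSwinnertonDyer.BirchSwinnertonDyer.Theorems.CyclotomicUntwistFormalLogBoundedIffDivisible
import Summits.BirchSwinnertonDyer.BirchSwinnertonDyer.Theorems.CyclotomicUntwistFormalEndomorphismFrobenius
import Literature.RingTheory.FormalGroups.HondaTypeTransport
import HarnessLib

/-!
# Route `CyclotomicUntwist`: the defect `γ_g = g(F) ⊖ F(g(X), g(Y))` of a series `g` — exact identities
# (`ℓ(γ_g) = ∂(ℓ∘g)`, `g(F) = F(γ_g, F(gX, gY))`) and base change (preparation for STEP B and the digit step)

Cell `pub/bsd-wall` (D-0145 line `route-BirchSwinnertonDyer-CyclotomicUntwist`), prover seat `bsd-line-cycu-p3` (gen 8),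
memo `KATZ-FROBENIUS-MOD-VARPI-v2` §2 (iii)–(iv), work package W3 toward the registered stub
`stub_KATZ_rankLeTwo_supersingular` of K1 = stmt-BirchSwinnertonDyer-21580 (binder H3 of cycu-p4's W4 assembly).
THEOREMS ONLY; `--supports` K1. BSD is not proved by this file and no crux is.

## Setting (general odd `p`)

`V/ℤ_p` with elliptic generic fibre `W = V ⊗ ℚ_p` and elliptic special fibre `V ⊗ 𝔽_p`, `F = F_W` (`= F_V`, integral),
`F̄ = F_{V ⊗ 𝔽_p}`, `ℓ = log_W`, `i = formalNeg`. For `g ∈ Xℤ_p⟦X⟧` write `ḡ ∈ X𝔽_p⟦X⟧` for its reduction and call `g` an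
*endomorphism mod `p`* when `ḡ(F̄(X,Y)) = F̄(ḡ(X), ḡ(Y))`.

* §1 exact identities over `ℚ_p`: `ℓ(F(A,B)) = ℓ(A) + ℓ(B)`, `ℓ(i(B)) = −ℓ(B)`, `ℓ(A) = ℓ(B) ⟹ A = B`, and for the
  *defect* `γ_g = F(g(F), i(F(g(X), g(Y))))`: `ℓ(γ_g) = ∂(ℓ∘g)` (the `F`-coboundary of `ℓ ∘ g`) and
  `g(F) = F(γ_g, F(g(X), g(Y)))`.
* §0 the same over any commutative ring, `F(T, i(T)) = 0`, and `φ(γ_G) = γ_{φG}` for a ring map `φ`.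
(STEP B and the digit step are in `CyclotomicUntwistSecondKindDigits`.)

[cite: Katz1981CrystallineDieudonne, §5.1 and Thm 5.3.3] [cite: SilvermanAEC2009, IV.4.3, IV.6.3, IV.7]
-/

set_option autoImplicit false
-- single-conjunct summit: `Summit.BirchSwinnertonDyer.BirchSwinnertonDyer.…` repeats the name by design
set_option linter.dupNamespace false

noncomputable section

open PowerSeries Literature.NumberTheory.EllipticCurves
  Summit.BirchSwinnertonDyer.BirchSwinnertonDyer.Theorems.FormalLogDivisibility
  Summit.BirchSwinnertonDyer.BirchSwinnertonDyer.Theorems.FormalEndomorphism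

namespace Summit.BirchSwinnertonDyer.BirchSwinnertonDyer.Theorems.SecondKindLog

variable {p : ℕ} [hp : Fact p.Prime]

/-! ## §0 The defect `γ_G = F(G(F), i(F(G(X₀), G(X₁))))` and its base change (any commutative ring) -/

section AnyRing

variable {R S : Type*} [CommRing R] [CommRing S] (U : WeierstrassCurve R) (φ : R →+* S) (G : R⟦X⟧)

/-- `G(X₀)`, `G(X₁)`, `G(F)` have no constant term when `G(0) = 0`. [folklore] -/
theorem constantCoeff_subst_three (hG : constantCoeff G = 0) :
    MvPowerSeries.constantCoeff (G.subst (MvPowerSeries.X 0 : MvPowerSeries (Fin 2) R)) = 0 ∧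
      MvPowerSeries.constantCoeff (G.subst (MvPowerSeries.X 1 : MvPowerSeries (Fin 2) R)) = 0 ∧
        MvPowerSeries.constantCoeff (G.subst U.formalGroupLaw) = 0 :=
  ⟨constantCoeff_powerSeries_subst_eq_zero (MvPowerSeries.constantCoeff_X 0) hG,
    constantCoeff_powerSeries_subst_eq_zero (MvPowerSeries.constantCoeff_X 1) hG,
    constantCoeff_powerSeries_subst_eq_zero U.constantCoeff_formalGroupLaw hG⟩

/-- `F(G(X₀), G(X₁))` has no constant term. [folklore] -/
theorem constantCoeff_pair (hG : constantCoeff G = 0) :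
    MvPowerSeries.constantCoeff (MvPowerSeries.subst ![G.subst (MvPowerSeries.X 0 : MvPowerSeries (Fin 2) R),
      G.subst (MvPowerSeries.X 1 : MvPowerSeries (Fin 2) R)] U.formalGroupLaw) = 0 := by
  obtain ⟨h0, h1, -⟩ := constantCoeff_subst_three U G hG
  exact MvPowerSeries.constantCoeff_subst_eq_zero (WeierstrassCurve.hasSubst_pair h0 h1)
    (fun i ↦ by fin_cases i; exacts [h0, h1]) U.constantCoeff_formalGroupLaw

/-- The defect `γ_G` has no constant term. [folklore] -/
theorem constantCoeff_defect (hG : constantCoeff G = 0) :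
    MvPowerSeries.constantCoeff (MvPowerSeries.subst ![G.subst U.formalGroupLaw, U.formalNeg.subst
      (MvPowerSeries.subst ![G.subst (MvPowerSeries.X 0 : MvPowerSeries (Fin 2) R),
        G.subst (MvPowerSeries.X 1 : MvPowerSeries (Fin 2) R)] U.formalGroupLaw)] U.formalGroupLaw) = 0 := by
  obtain ⟨-, -, hF⟩ := constantCoeff_subst_three U G hG
  have hN := constantCoeff_powerSeries_subst_eq_zero (constantCoeff_pair U G hG) U.constantCoeff_formalNeg
  exact MvPowerSeries.constantCoeff_subst_eq_zero (WeierstrassCurve.hasSubst_pair hF hN)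
    (fun i ↦ by fin_cases i; exacts [hF, hN]) U.constantCoeff_formalGroupLaw

/-- On one-variable series `MvPowerSeries.map` is `PowerSeries.map`. [folklore] -/
theorem mvMap_eq_map (f : R⟦X⟧) : MvPowerSeries.map φ f = PowerSeries.map φ f := rfl

/-- `φ(G(F_U)) = (φG)(F_{φU})`. [folklore] -/
theorem map_subst_formalGroupLaw :
    (G.subst U.formalGroupLaw).map φ = (G.map φ).subst (U.map φ).formalGroupLaw := by
  rw [PowerSeries.map_subst U.hasSubst_formalGroupLaw, U.map_formalGroupLaw φ]

/-- `φ(G(Xᵢ)) = (φG)(Xᵢ)`. [folklore] -/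
theorem map_subst_X (i : Fin 2) :
    (G.subst (MvPowerSeries.X i : MvPowerSeries (Fin 2) R)).map φ =
      (G.map φ).subst (MvPowerSeries.X i : MvPowerSeries (Fin 2) S) := by
  rw [PowerSeries.map_subst (PowerSeries.HasSubst.X i), MvPowerSeries.map_X]

/-- `φ(F(G(X₀), G(X₁))) = F_{φU}((φG)(X₀), (φG)(X₁))`. [folklore] -/
theorem map_pair (hG : constantCoeff G = 0) :
    (MvPowerSeries.subst ![G.subst (MvPowerSeries.X 0 : MvPowerSeries (Fin 2) R),
      G.subst (MvPowerSeries.X 1 : MvPowerSeries (Fin 2) R)] U.formalGroupLaw).map φ =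
      MvPowerSeries.subst ![(G.map φ).subst (MvPowerSeries.X 0 : MvPowerSeries (Fin 2) S),
        (G.map φ).subst (MvPowerSeries.X 1 : MvPowerSeries (Fin 2) S)] (U.map φ).formalGroupLaw := by
  obtain ⟨h0, h1, -⟩ := constantCoeff_subst_three U G hG
  rw [U.map_subst_pair_formalGroupLaw φ h0 h1, map_subst_X φ G 0, map_subst_X φ G 1]

/-- **The defect commutes with base change**: `φ(γ_G) = γ_{φG}` (computed for `F_{φU}`). [folklore] -/
theorem map_defect (hG : constantCoeff G = 0) :
    (MvPowerSeries.subst ![G.subst U.formalGroupLaw, U.formalNeg.subst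
      (MvPowerSeries.subst ![G.subst (MvPowerSeries.X 0 : MvPowerSeries (Fin 2) R),
        G.subst (MvPowerSeries.X 1 : MvPowerSeries (Fin 2) R)] U.formalGroupLaw)] U.formalGroupLaw).map φ =
      MvPowerSeries.subst ![(G.map φ).subst (U.map φ).formalGroupLaw, (U.map φ).formalNeg.subst
        (MvPowerSeries.subst ![(G.map φ).subst (MvPowerSeries.X 0 : MvPowerSeries (Fin 2) S),
          (G.map φ).subst (MvPowerSeries.X 1 : MvPowerSeries (Fin 2) S)] (U.map φ).formalGroupLaw)]
        (U.map φ).formalGroupLaw := by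
  obtain ⟨-, -, hF⟩ := constantCoeff_subst_three U G hG
  have hP := constantCoeff_pair U G hG
  rw [U.map_subst_pair_formalGroupLaw φ hF (constantCoeff_powerSeries_subst_eq_zero hP U.constantCoeff_formalNeg),
    map_subst_formalGroupLaw U φ G, PowerSeries.map_subst (PowerSeries.HasSubst.of_constantCoeff_zero hP),
    U.map_formalNeg φ, map_pair U φ G hG]

/-- **`F(T, i(T)) = 0`** for any several-variable `T` without constant term. [cite: SilvermanAEC2009, IV.2.1] -/
theorem subst_pair_formalNeg_self {σ : Type*} {T : MvPowerSeries σ R} (hT : MvPowerSeries.constantCoeff T = 0) :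
    MvPowerSeries.subst ![T, U.formalNeg.subst T] U.formalGroupLaw = 0 := by
  have hs : MvPowerSeries.HasSubst ![(PowerSeries.X : R⟦X⟧), U.formalNeg] :=
    WeierstrassCurve.hasSubst_pair PowerSeries.constantCoeff_X U.constantCoeff_formalNeg
  have hTs : PowerSeries.HasSubst T := PowerSeries.HasSubst.of_constantCoeff_zero hT
  have key := congrArg (PowerSeries.subst T) U.formalGroupLaw_subst_X_formalNeg'
  rw [← PowerSeries.coe_substAlgHom hTs, map_zero, PowerSeries.coe_substAlgHom hTs, PowerSeries.subst,
    MvPowerSeries.subst_comp_subst_apply hs hTs.const] at key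
  rw [← key]
  congr 1
  funext i
  fin_cases i
  · exact (PowerSeries.subst_X hTs).symm
  · rfl

end AnyRing

/-! ## §1 Exact identities over `ℚ_p` -/

section Rational

variable (W : WeierstrassCurve ℚ_[p])

/-- **`ℓ(F(A, B)) = ℓ(A) + ℓ(B)`** for several-variable arguments without constant term. [cite: SilvermanAEC2009, IV.5.2] -/
theorem formalLog_subst_pair {σ : Type*} {A B : MvPowerSeries σ ℚ_[p]} (hA : MvPowerSeries.constantCoeff A = 0)
    (hB : MvPowerSeries.constantCoeff B = 0) :
    W.formalLog.subst (MvPowerSeries.subst ![A, B] W.formalGroupLaw) = W.formalLog.subst A + W.formalLog.subst B := by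
  have hb : MvPowerSeries.HasSubst ![A, B] := WeierstrassCurve.hasSubst_pair hA hB
  have h := congrArg (MvPowerSeries.subst ![A, B]) W.formalLog_subst_formalGroupLaw
  rw [MvPowerSeries.subst_add hb, mvSubst_powerSeries_subst W.hasSubst_formalGroupLaw hb,
    mvSubst_powerSeries_subst (PowerSeries.HasSubst.X _) hb, mvSubst_powerSeries_subst (PowerSeries.HasSubst.X _) hb,
    MvPowerSeries.subst_X hb, MvPowerSeries.subst_X hb] at h
  exact h

/-- **`ℓ(i(B)) = −ℓ(B)`**. [cite: SilvermanAEC2009, IV.5.2] -/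
theorem formalLog_subst_formalNeg_subst {σ : Type*} {B : MvPowerSeries σ ℚ_[p]}
    (hB : MvPowerSeries.constantCoeff B = 0) :
    W.formalLog.subst (W.formalNeg.subst B) = -W.formalLog.subst B := by
  have hBs : PowerSeries.HasSubst B := PowerSeries.HasSubst.of_constantCoeff_zero hB
  rw [← PowerSeries.subst_comp_subst_apply (PowerSeries.HasSubst.of_constantCoeff_zero' W.constantCoeff_formalNeg) hBs,
    W.formalLog_subst_formalNeg, ← PowerSeries.coe_substAlgHom hBs, map_neg]

/-- **`ℓ(F(A, i(B))) = ℓ(A) − ℓ(B)`**. [cite: SilvermanAEC2009, IV.5.2] -/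
theorem formalLog_subst_fsub {σ : Type*} {A B : MvPowerSeries σ ℚ_[p]} (hA : MvPowerSeries.constantCoeff A = 0)
    (hB : MvPowerSeries.constantCoeff B = 0) :
    W.formalLog.subst (MvPowerSeries.subst ![A, W.formalNeg.subst B] W.formalGroupLaw) =
      W.formalLog.subst A - W.formalLog.subst B := by
  rw [formalLog_subst_pair W hA (constantCoeff_powerSeries_subst_eq_zero hB W.constantCoeff_formalNeg),
    formalLog_subst_formalNeg_subst W hB, sub_eq_add_neg]

/-- **`ℓ` is injective on arguments**: `ℓ(A) = ℓ(B) ⟹ A = B` (apply `exp_W`). [cite: SilvermanAEC2009, IV.5.5] -/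
theorem eq_of_formalLog_subst_eq {σ : Type*} {A B : MvPowerSeries σ ℚ_[p]} (hA : MvPowerSeries.constantCoeff A = 0)
    (hB : MvPowerSeries.constantCoeff B = 0) (h : W.formalLog.subst A = W.formalLog.subst B) : A = B := by
  have hℓ : PowerSeries.HasSubst W.formalLog := PowerSeries.HasSubst.of_constantCoeff_zero' W.constantCoeff_formalLog
  have key : ∀ {C : MvPowerSeries σ ℚ_[p]}, MvPowerSeries.constantCoeff C = 0 →
      W.formalExp.subst (W.formalLog.subst C) = C := fun {C} hC ↦ by
    have hCs : PowerSeries.HasSubst C := PowerSeries.HasSubst.of_constantCoeff_zero hC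
    rw [← PowerSeries.subst_comp_subst_apply hℓ hCs, W.formalExp_subst_formalLog, PowerSeries.subst_X hCs]
  rw [← key hA, ← key hB, h]

variable (g : ℚ_[p]⟦X⟧)

/-- **`ℓ(γ_g) = ∂(ℓ ∘ g)`** for the defect `γ_g = F(g(F), i(F(g(X₀), g(X₁))))`: the `F`-coboundary of `ℓ ∘ g` is the
logarithm of an (integral, if `g` is) series. [cite: Katz1981CrystallineDieudonne, §5.1] -/
theorem formalLog_subst_defect (hg : constantCoeff g = 0) :
    W.formalLog.subst (MvPowerSeries.subst ![g.subst W.formalGroupLaw, W.formalNeg.subst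
        (MvPowerSeries.subst ![g.subst (MvPowerSeries.X 0 : MvPowerSeries (Fin 2) ℚ_[p]),
          g.subst (MvPowerSeries.X 1 : MvPowerSeries (Fin 2) ℚ_[p])] W.formalGroupLaw)] W.formalGroupLaw) =
      PowerSeries.subst W.formalGroupLaw (W.formalLog.subst g) -
        PowerSeries.subst (MvPowerSeries.X 0 : MvPowerSeries (Fin 2) ℚ_[p]) (W.formalLog.subst g) -
          PowerSeries.subst (MvPowerSeries.X 1 : MvPowerSeries (Fin 2) ℚ_[p]) (W.formalLog.subst g) := by
  obtain ⟨h0, h1, hF⟩ := constantCoeff_subst_three W g hg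
  have hgs : PowerSeries.HasSubst g := PowerSeries.HasSubst.of_constantCoeff_zero' hg
  have hP := constantCoeff_pair W g hg
  have e1 : PowerSeries.subst W.formalGroupLaw (W.formalLog.subst g) = W.formalLog.subst (g.subst W.formalGroupLaw) :=
    PowerSeries.subst_comp_subst_apply hgs W.hasSubst_formalGroupLaw _
  have e2 : PowerSeries.subst (MvPowerSeries.X 0 : MvPowerSeries (Fin 2) ℚ_[p]) (W.formalLog.subst g) =
      W.formalLog.subst (g.subst (MvPowerSeries.X 0 : MvPowerSeries (Fin 2) ℚ_[p])) :=
    PowerSeries.subst_comp_subst_apply hgs (PowerSeries.HasSubst.X _) _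
  have e3 : PowerSeries.subst (MvPowerSeries.X 1 : MvPowerSeries (Fin 2) ℚ_[p]) (W.formalLog.subst g) =
      W.formalLog.subst (g.subst (MvPowerSeries.X 1 : MvPowerSeries (Fin 2) ℚ_[p])) :=
    PowerSeries.subst_comp_subst_apply hgs (PowerSeries.HasSubst.X _) _
  rw [formalLog_subst_fsub W hF hP, formalLog_subst_pair W h0 h1, e1, e2, e3]
  ring

/-- **`g(F) = F(γ_g, F(g(X₀), g(X₁)))`** (both sides have the same logarithm). [cite: SilvermanAEC2009, IV.5.5] -/
theorem subst_formalGroupLaw_eq_defect (hg : constantCoeff g = 0) :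
    g.subst W.formalGroupLaw = MvPowerSeries.subst ![MvPowerSeries.subst ![g.subst W.formalGroupLaw, W.formalNeg.subst
        (MvPowerSeries.subst ![g.subst (MvPowerSeries.X 0 : MvPowerSeries (Fin 2) ℚ_[p]),
          g.subst (MvPowerSeries.X 1 : MvPowerSeries (Fin 2) ℚ_[p])] W.formalGroupLaw)] W.formalGroupLaw,
      MvPowerSeries.subst ![g.subst (MvPowerSeries.X 0 : MvPowerSeries (Fin 2) ℚ_[p]),
        g.subst (MvPowerSeries.X 1 : MvPowerSeries (Fin 2) ℚ_[p])] W.formalGroupLaw] W.formalGroupLaw := by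
  obtain ⟨-, -, hF⟩ := constantCoeff_subst_three W g hg
  have hP := constantCoeff_pair W g hg
  have hγ := constantCoeff_defect W g hg
  refine eq_of_formalLog_subst_eq W hF (MvPowerSeries.constantCoeff_subst_eq_zero (WeierstrassCurve.hasSubst_pair hγ hP)
    (fun i ↦ by fin_cases i; exacts [hγ, hP]) W.constantCoeff_formalGroupLaw) ?_
  rw [formalLog_subst_pair W hγ hP, formalLog_subst_fsub W hF hP]
  ring

/-- `[X¹](ℓ(u)) = [X¹]u` for `u ∈ Xℚ_p⟦X⟧` (`ℓ = X + O(X²)`). [folklore] -/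
theorem coeff_one_formalLog_subst {u : ℚ_[p]⟦X⟧} (hu : constantCoeff u = 0) :
    coeff 1 (W.formalLog.subst u) = coeff 1 u := by
  rw [Literature.RingTheory.FormalGroups.coeff_subst_eq_sum hu, Finset.sum_range_succ, Finset.sum_range_succ,
    Finset.sum_range_zero, zero_add, coeff_zero_eq_constantCoeff_apply, W.constantCoeff_formalLog, zero_mul, zero_add,
    W.coeff_one_formalLog, one_mul, pow_one]

end Rational

end Summit.BirchSwinnertonDyer.BirchSwinnertonDyer.Theorems.SecondKindLog
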